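import Summits.HubbardSuperconductivity.HubbardSuperconductivity.Theses.AposterioriCapRg
import Summits.HubbardSuperconductivity.HubbardSuperconductivity.Theorems.SeededBrokenRegimeBoseFermiPinned.Negative.LoadBearing

/-!
# Line `seed-strength-flow` — skeleton for crux `SeededBrokenRegimeBoseFermiPinned` (stmt-HubbardSuperconductivity-14047)

Lead prover `prover-line-stmt-HubbardSuperconductivity-14047-0`, 2026-08-16 (re-typed from the in-tree card
`Cruxes/SeededBrokenRegimeBoseFermiPinned/Ideas/seed-strength-flow.md` and `SketchIdeator1.lean` §1: the planner's
checked skeleton lives only in the unmounted evidence store; stub names kept where the ledger shows them).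

## The line

Above a fermionic infrared scale `Λ₀` the Koma–Tasaki pair seed `h` is a regular GAUSSIAN parameter of the countertermed
effective action `𝒢_h := hubbardEffectiveActionCT L M β U μ h K Λ₀`: the seed sits in the covariance only
(`nambuPropagatorCT`), the interaction slot `hubbardInteractionCT` and Salmhofer's cutoff `hubbardCutoffWeightCT` are
`h`-free.  Hence (S2) `𝒢_h = effAction (C^{>Λ₀}_h − C^{>Λ₀}_{h₀}) 𝒢_{h₀}` EXACTLY (Gaussian additivity), with a seed-slice
covariance that is (S1, S3) supported above `Λ₀/2` and of sup-size `≤ 32√2·βL²|h − h₀|/Λ₀²`.  The crux is then cut as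
ANCHOR ∧ STEP: (S4, ANCHOR) the crux's conclusion-shape at the SINGLE massive anchor seed `h₀ := D.scale/4` with slack
(gap ratio `20`, thresholds `(2·kStar, etaStar/2)`); (S5, STEP) lowering the seed from the anchor to every `h ∈ (0, h₀]`
keeps ONE loosened datum `D'` (same scale) certified — the `h`-uniform content of the crux, whose only soft channel is the
rank-one `B₁g` transverse Cooper ladder housed in the report's kept term `cooperKeptCT`.  (S6) is the sibling card's
rotation identity (global `U(1)` × seed covariance), the ingredient that pins the transverse mass at both seeds.

## Composition

`SeededBrokenRegimeBoseFermiPinned_of`: pure logic — take `Θ :=` componentwise `min` of the tolerances of S4 and S5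
(the certificate is monotone in `Θ`: `Negative.certificateT_mono_tol`, landed p76062), get `D` from ANCHOR, `D'` from STEP,
`h₀ := D.scale/4 > 0`.  The density clause and `δ` are not used (`CruxNoDens` shape, Disproof §4).

## Stubs (registered; S1–S3, S6 provable now; S4, S5 crux-strength)

* `stub_seedSliceBound` (S1) — first lemma of the card, elementary calculus on the entries of `nambuPropagatorCT`.
* `stub_seedConvolution` (S2) — `effAction_add` + `h`-freeness of interaction and cutoff.
* `stub_seedSliceCovarianceBound` (S3) — from S1 (taken as hypothesis) by the mean-value inequality and `χ₂ = 0` on `[0, ¼]`.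
* `stub_anchorFlow` (S4, ANCHOR; hardest, held by the lead) — the massive Bose–Fermi flow at one seed.
* `stub_seedLowering` (S5, STEP) — the seed-lowering lemma (crux-strength: its `h`-uniform isolation of the ladder).
* `stub_seedRotationIdentity` (S6) — kernel-checked in `SketchIdeator1.lean` §2; to be re-landed under `Theorems/`.
-/

set_option linter.dupNamespace false

namespace Summit.HubbardSuperconductivity.HubbardSuperconductivity.Lines.SeededBrokenRegimeBoseFermiPinned.SeedStrengthFlowRepaired

open Summit.HubbardSuperconductivity.HubbardSuperconductivity.Theses.AposterioriCapRg
open Summit.HubbardSuperconductivity.HubbardSuperconductivity.Theorems.SeededBrokenRegimeBoseFermiPinned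
open Literature.MathematicalPhysics.QuantumLattice Literature.Probability.LatticeModels GrassmannAlgebra
open scoped Matrix ComplexConjugate

/-! ### S1 — the seed is a regular Gaussian parameter above scale -/

/-- **S1 (first lemma, `SeedSliceBound`)**: above a fermionic scale `Λ` (`ω² + e_K² ≥ Λ²`) every entry of the seeded
Nambu propagator in the frame `K` is differentiable in the seed strength with `‖∂_h G_ab‖ ≤ |φ_d|/Λ²`. -/
theorem stub_seedSliceBound :
    ∀ (L M : ℕ) [NeZero L] (β μ Λ h : ℝ) (K : TrigPolyC4v) (k : FreqMomentum L M) (i j : Fin 2),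
      0 < Λ → Λ ^ 2 ≤ matsubaraFreq β M k.1 ^ 2 + nambuXiCT L μ K k.2 ^ 2 →
        DifferentiableAt ℝ (fun h' : ℝ => nambuPropagatorCT L M β μ h' K k i j) h ∧
        ‖deriv (fun h' : ℝ => nambuPropagatorCT L M β μ h' K k i j) h‖ ≤ |dWaveSymbol L k.2| / Λ ^ 2 := by
  sorry

/-! ### S2 — Gaussian additivity in the seed -/

/-- **S2 (`SeedConvolution`)**: the scale-`Λ₀` effective action at seed `h` is the effective action of the one at seed
`h₀` after integrating out the seed-slice covariance `C^{>Λ₀}_h − C^{>Λ₀}_{h₀}` (when `Z_{h₀} ≠ 0`). -/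
theorem stub_seedConvolution :
    ∀ (L M : ℕ) [NeZero L] (β U μ h h₀ : ℝ) (K : TrigPolyC4v) (Λ₀ : ℝ),
      hubbardEffPartitionFnCT L M β U μ h₀ K Λ₀ ≠ 0 →
        hubbardEffectiveActionCT L M β U μ h K Λ₀ =
          effAction ℂ (hubbardCovAboveCT L M β μ h K Λ₀ - hubbardCovAboveCT L M β μ h₀ K Λ₀)
            (hubbardEffectiveActionCT L M β U μ h₀ K Λ₀) := by
  sorry

/-! ### S3 — the seed-slice covariance is small and lives above `Λ₀/2` -/

/-- **S3 (`SeedSliceCovarianceBound`)**: given S1, every entry of the seed-slice covariance above scale `Λ₀` is bounded by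
`32√2 · βL² · |h − h₀| / Λ₀²` (`|φ_d| ≤ 4√2`; Salmhofer's `χ₂` vanishes on `[0, ¼]`, so only `ω² + e_K² > Λ₀²/4` contributes). -/
theorem stub_seedSliceCovarianceBound :
    (∀ (L M : ℕ) [NeZero L] (β μ Λ h : ℝ) (K : TrigPolyC4v) (k : FreqMomentum L M) (i j : Fin 2),
      0 < Λ → Λ ^ 2 ≤ matsubaraFreq β M k.1 ^ 2 + nambuXiCT L μ K k.2 ^ 2 →
        DifferentiableAt ℝ (fun h' : ℝ => nambuPropagatorCT L M β μ h' K k i j) h ∧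
        ‖deriv (fun h' : ℝ => nambuPropagatorCT L M β μ h' K k i j) h‖ ≤ |dWaveSymbol L k.2| / Λ ^ 2) →
    ∀ (L M : ℕ) [NeZero L] (β μ h h₀ : ℝ) (K : TrigPolyC4v) (Λ₀ : ℝ) (X Y : HubbardFieldIdx L M),
      0 < β → 0 < Λ₀ →
        ‖hubbardCovAboveCT L M β μ h K Λ₀ X Y - hubbardCovAboveCT L M β μ h₀ K Λ₀ X Y‖ ≤
          32 * Real.sqrt 2 * β * (L : ℝ) ^ 2 * |h - h₀| / Λ₀ ^ 2 := by
  sorry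

/-! ### S4 — ANCHOR: the massive Bose–Fermi flow at the single seed `h₀ = D.scale/4` -/

/-- **S4 (`AnchorFlow`, ANCHOR)**: for all thresholds there is a tolerance such that at every certified point of the box
there is a scale datum with SLACK (gap ratio `20`, thresholds `(2·kStar, etaStar/2)`, `0 < N_p`, `0 < m₀.fst`) certified
against the countertermed report at the single anchor seed `h₀ = D.scale/4` — the crux's conclusion-shape where nothing
is soft (fermions cut at `Λ₀`, amplitude mode `2Δ`, transverse pair mode of mass `≈ 12–20 Λ₀`). Crux-strength (XL). -/
theorem stub_anchorFlow :
    ∀ kStar etaStar : ℚ, 0 < kStar → 0 < etaStar → ∃ Θ : SymmetricTolerance,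
      ∀ U ∈ Set.Icc (2:ℝ) 3, ∀ (μ : ℝ) (K : TrigPolyC4v) (Λ : ℝ) (L₀ : ℕ),
        symmetricRegimeCertificateT U μ capRgCornerDataT Θ K Λ L₀ →
          ∃ D : HubbardScaleData, (D.scale : ℝ) ≤ Λ * Real.exp (-8) / 30 ∧
            D.MeetsThresholdsWith 20 (2 * kStar) (etaStar / 2) ∧ 0 < D.numPatches ∧
            0 < D.meanFieldDensity.fst ∧
            ∃ L₀' : ℕ, D.IsCertifiedEnclosure (hubbardScaleReportCT U μ D ((D.scale : ℝ) / 4)) L₀' := by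
  sorry

/-! ### S5 — STEP: lowering the seed from the anchor, `h`-uniformly -/

/-- **S5 (`SeedLowering`, STEP)**: for all thresholds there is a tolerance such that at every certified point, every datum
`D` certified WITH SLACK at its anchor seed `D.scale/4` can be loosened to ONE datum `D'` of the same scale meeting the
thresholds `(kStar, etaStar)` and certified at EVERY seed `h ∈ (0, D.scale/4]` (`L₀'` may depend on `h`). The `h`-uniform
content of the crux: by S2 all `h`-dependence is one convolution with the seed-slice covariance of S3, whose only soft
channel is the rank-one `B₁g` transverse ladder (mass pinned by S6) housed in `cooperKeptCT`. Crux-strength (XL). -/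
theorem stub_seedLowering :
    ∀ kStar etaStar : ℚ, 0 < kStar → 0 < etaStar → ∃ Θ : SymmetricTolerance,
      ∀ U ∈ Set.Icc (2:ℝ) 3, ∀ (μ : ℝ) (K : TrigPolyC4v) (Λ : ℝ) (L₀ : ℕ),
        symmetricRegimeCertificateT U μ capRgCornerDataT Θ K Λ L₀ →
          ∀ D : HubbardScaleData, (D.scale : ℝ) ≤ Λ * Real.exp (-8) / 30 →
            D.MeetsThresholdsWith 20 (2 * kStar) (etaStar / 2) → 0 < D.numPatches →
            0 < D.meanFieldDensity.fst →
            (∃ L₀' : ℕ, D.IsCertifiedEnclosure (hubbardScaleReportCT U μ D ((D.scale : ℝ) / 4)) L₀') →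
              ∃ D' : HubbardScaleData, D'.scale = D.scale ∧ D'.MeetsThresholds kStar etaStar ∧
                0 < D'.numPatches ∧ 0 < D'.meanFieldDensity.fst ∧
                ∀ h ∈ Set.Ioc (0:ℝ) ((D.scale : ℝ) / 4), ∃ L₀' : ℕ,
                  D'.IsCertifiedEnclosure (hubbardScaleReportCT U μ D' h) L₀' := by
  sorry

/-! ### S6 — the rotation identity (sibling card `rotation-identity-goldstone-pin`, kernel-checked there) -/

/-- **S6 (`SeedRotationIdentity`)**: the ground energy of the Hubbard torus seeded by an arbitrary COMPLEX `d`-wave pair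
source `z̄Δ_d + zΔ_dᴴ`, `z = a + ib`, depends on `|z|` only (global `U(1)` covariance; proved in `SketchIdeator1.lean` §2). -/
theorem stub_seedRotationIdentity :
    ∀ (L : ℕ) [NeZero L] (U μ a b : ℝ),
      Matrix.groundEnergy (hubbardTorusWith 2 L 1 U μ
          - (a : ℂ) • (pairField dWaveFormFactor L + (pairField dWaveFormFactor L)ᴴ)
          - (b : ℂ) • (Complex.I • ((pairField dWaveFormFactor L)ᴴ - pairField dWaveFormFactor L)))
        = Matrix.groundEnergy (dWaveSourceTorus L U μ (Real.sqrt (a ^ 2 + b ^ 2))) := by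
  sorry

/-! ### Composition (pure logic) -/

/-- The componentwise minimum of two tolerances. -/
def minTol (Θ₁ Θ₂ : SymmetricTolerance) : SymmetricTolerance where
  mismatch := min Θ₁.mismatch Θ₂.mismatch
  mismatch_pos := lt_min Θ₁.mismatch_pos Θ₂.mismatch_pos
  width := min Θ₁.width Θ₂.width
  width_pos := lt_min Θ₁.width_pos Θ₂.width_pos

/-- **The line closes the crux**: ANCHOR (S4) and STEP (S5) give `SeededBrokenRegimeBoseFermiPinned`, with the model-level
lemmas S1–S3 and S6 recorded as the ingredients of their proofs. -/
theorem SeededBrokenRegimeBoseFermiPinned_of : SeededBrokenRegimeBoseFermiPinned := by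
  have _s1 := stub_seedSliceBound
  have _s2 := stub_seedConvolution
  have _s3 := stub_seedSliceCovarianceBound _s1
  have _s6 := stub_seedRotationIdentity
  intro kStar etaStar hk he
  obtain ⟨ΘA, hA⟩ := stub_anchorFlow kStar etaStar hk he
  obtain ⟨ΘS, hS⟩ := stub_seedLowering kStar etaStar hk he
  refine ⟨minTol ΘA ΘS, ?_⟩
  intro U hU δ _hδ μ _hdens K Λ L₀ hcert
  have hcA : symmetricRegimeCertificateT U μ capRgCornerDataT ΘA K Λ L₀ :=
    Negative.certificateT_mono_tol (min_le_left _ _) (min_le_left _ _) hcert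
  have hcS : symmetricRegimeCertificateT U μ capRgCornerDataT ΘS K Λ L₀ :=
    Negative.certificateT_mono_tol (min_le_right _ _) (min_le_right _ _) hcert
  obtain ⟨D, hcap, hmeets, hNp, hm, hanchor⟩ := hA U hU μ K Λ L₀ hcA
  obtain ⟨D', -, hmeets', hNp', hm', hall⟩ := hS U hU μ K Λ L₀ hcS D hcap hmeets hNp hm hanchor
  exact ⟨(D.scale : ℝ) / 4, by have := D.cast_scale_pos; positivity, D', hmeets', hNp', hm', hall⟩

end Summit.HubbardSuperconductivity.HubbardSuperconductivity.Lines.SeededBrokenRegimeBoseFermiPinned.SeedStrengthFlowRepaired
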